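import Literature.AnabelianGeometry.SemiGraphs.HomCompositionLaws

/-!
# The 1-category of semi-graphs of anabelioids up to 2-isomorphism ([SemiAnbd] §2, Rmk 2.4.2) — merge step M3 (first half)

Mochizuki, *Semi-graphs of anabelioids*, Publ. RIMS **42** (2006), §2 Remark 2.4.2, author's
manuscript p.26 (kurims `paper:url-f33ace170ff4`). [cite: MochizukiSemiAnbd2006, Rmk 2.4.2, p. 26]

CONSTRUCTION ONLY (L3 bridge, step M3a; cell ruling abc-iut-L3-lead 2026-08-25T20:36Z).  Remark
2.4.2: "the 1-morphisms from `𝒢` to `ℋ` form a category"; for totally aloof, verticially slim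
semi-graphs of anabelioids and locally open 1-morphisms "`φ` has no nontrivial automorphisms", so
that "we may work with such morphisms as if they are simply morphisms in a category, i.e., by
ignoring 2-morphisms and identifying isomorphic 1-morphisms. We shall often do this …" — the
convention under which §§4–5 are written (the ambient `Category Obj` of the §4 container
`SemiAnbdVocab`).  This file builds the underlying quotient 1-category on ALL semi-graphs of
anabelioids and ALL 1-morphisms:

* `HomOver.iso2Setoid` — "2-isomorphic" (a 2-cell `Iso2` exists) is an equivalence relation on the
  1-morphisms over a fixed morphism of underlying semi-graphs (`Iso2.refl/symm/trans`);
* `SgAQuot` — a one-field wrapper of `SemiGraphOfAnabelioids` (so that no instance is imposed on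
  t1's structure) with `instance : Category SgAQuot`: an arrow `X ⟶ Y` is a pair
  `⟨f, [φ]⟩` of a morphism `f` of underlying semi-graphs and a 2-isomorphism class of 1-morphisms
  over `f`; composition by `HomOver.comp` (well defined by `Iso2.hcomp`), unit and associativity
  laws from `idCompIso2` / `compIdIso2` / `assocIso2` (the bases compose strictly).

Deliberately NOT here (M3b, recorded debt): the full-and-wide subcategory of totally aloof,
verticially slim objects (every edge abutting to a vertex, [IUTchI] Rmk 2.5.3 (iii)) and locally
open arrows — the `Obj` of `SemiAnbdVocab` — and the fact that there 2-isomorphism classes are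
rigid (`remark_2_4_2_rigid`).  No printed statement is (re-)typed here.
-/

namespace Literature.AnabelianGeometry.SemiGraphs

open CategoryTheory Literature.AnabelianGeometry.Anabelioids

universe v₁ u₁ u

namespace SemiGraphOfAnabelioids

variable (𝒢 ℋ : SemiGraphOfAnabelioids.{v₁, u₁, u})

/-- "Isomorphic 1-morphisms" over a fixed morphism `f` of underlying semi-graphs: a 2-cell exists.
An equivalence relation (`Iso2.refl`, `Iso2.symm`, `Iso2.trans`). [cite: MochizukiSemiAnbd2006, Rmk 2.4.2, p. 26] -/
def HomOver.iso2Setoid (f : 𝒢.graph ⟶ ℋ.graph) : Setoid (HomOver 𝒢 ℋ f) where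
  r φ φ' := Nonempty (HomOver.Iso2 φ φ')
  iseqv := ⟨fun φ => ⟨HomOver.Iso2.refl φ⟩, fun ⟨σ⟩ => ⟨σ.symm⟩, fun ⟨σ⟩ ⟨τ⟩ => ⟨σ.trans τ⟩⟩

end SemiGraphOfAnabelioids

-- justification: as for `SemiGraphOfAnabelioids` itself (and Mathlib's `Cat.{v, u}`), the three
-- universes of the wrapped structure occur only together in the wrapper's type.
set_option linter.checkUnivs false in
/-- A semi-graph of anabelioids, as an object of the 1-category of [SemiAnbd] Rmk 2.4.2 (one-field
wrapper: the category instance below lives on this type, not on t1's structure).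
[cite: MochizukiSemiAnbd2006, Rmk 2.4.2, p. 26] -/
structure SgAQuot : Type (max (u + 1) (u₁ + 1) (v₁ + 1)) where
  /-- the underlying semi-graph of anabelioids -/
  toSgA : SemiGraphOfAnabelioids.{v₁, u₁, u}

namespace SgAQuot

open SemiGraphOfAnabelioids

/-- Arrows of the 1-category: a morphism of underlying semi-graphs together with a 2-isomorphism
class of 1-morphisms over it ("identifying isomorphic 1-morphisms").
[cite: MochizukiSemiAnbd2006, Rmk 2.4.2, p. 26] -/
structure Hom (X Y : SgAQuot.{v₁, u₁, u}) : Type (max u (u₁ + 1) (v₁ + 1)) where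
  /-- the underlying morphism of semi-graphs -/
  base : X.toSgA.graph ⟶ Y.toSgA.graph
  /-- the 2-isomorphism class of 1-morphisms over `base` -/
  cls : Quotient (HomOver.iso2Setoid X.toSgA Y.toSgA base)

/-- Two arrows with the same base and the same class are equal. [cite: MochizukiSemiAnbd2006, Rmk 2.4.2, p. 26] -/
theorem Hom.ext' {X Y : SgAQuot.{v₁, u₁, u}} {a b : Hom X Y} (h₁ : a.base = b.base)
    (h₂ : h₁ ▸ a.cls = b.cls) : a = b := by
  cases a; cases b; cases h₁; cases h₂; rfl

/-- Composition of arrows: compose bases and compose representatives (`HomOver.comp`), well defined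
on classes by the congruence `Iso2.hcomp`. [cite: MochizukiSemiAnbd2006, Rmk 2.4.2, p. 26] -/
noncomputable def Hom.comp {X Y Z : SgAQuot.{v₁, u₁, u}} (a : Hom X Y) (b : Hom Y Z) : Hom X Z :=
  ⟨a.base ≫ b.base,
    Quotient.map₂ (sa := HomOver.iso2Setoid _ _ a.base) (sb := HomOver.iso2Setoid _ _ b.base)
      (sc := HomOver.iso2Setoid _ _ (a.base ≫ b.base)) HomOver.comp
      (fun _ _ hφ _ _ hψ => by
        obtain ⟨σ⟩ := hφ
        obtain ⟨τ⟩ := hψ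
        exact ⟨σ.hcomp τ⟩) a.cls b.cls⟩

/-- **The 1-category of semi-graphs of anabelioids with 2-isomorphism classes of 1-morphisms as
arrows** (Rmk 2.4.2). [cite: MochizukiSemiAnbd2006, Rmk 2.4.2, p. 26] -/
noncomputable instance : Category SgAQuot.{v₁, u₁, u} where
  Hom := Hom
  id X := ⟨𝟙 X.toSgA.graph, Quotient.mk _ (HomOver.id X.toSgA)⟩
  comp := Hom.comp
  id_comp {X Y} a := by
    obtain ⟨f, a⟩ := a
    induction a using Quotient.ind with
    | _ φ => exact congrArg (Hom.mk f) (Quotient.sound ⟨HomOver.idCompIso2 φ⟩)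
  comp_id {X Y} a := by
    obtain ⟨f, a⟩ := a
    induction a using Quotient.ind with
    | _ φ => exact congrArg (Hom.mk f) (Quotient.sound ⟨HomOver.compIdIso2 φ⟩)
  assoc {W X Y Z} a b c := by
    obtain ⟨f, a⟩ := a
    obtain ⟨g, b⟩ := b
    obtain ⟨k, c⟩ := c
    induction a using Quotient.ind with
    | _ φ =>
      induction b using Quotient.ind with
      | _ ψ =>
        induction c using Quotient.ind with
        | _ χ => exact congrArg (Hom.mk _) (Quotient.sound ⟨HomOver.assocIso2 φ ψ χ⟩)

/-- The arrow `X ⟶ Y` defined by a 1-morphism over `f` (its 2-isomorphism class).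
[cite: MochizukiSemiAnbd2006, Rmk 2.4.2, p. 26] -/
def homMk {X Y : SgAQuot.{v₁, u₁, u}} {f : X.toSgA.graph ⟶ Y.toSgA.graph}
    (φ : HomOver X.toSgA Y.toSgA f) : X ⟶ Y :=
  ⟨f, Quotient.mk _ φ⟩

/-- The arrow of the 1-category defined by a 1-morphism of semi-graphs of anabelioids.
[cite: MochizukiSemiAnbd2006, Rmk 2.4.2, p. 26] -/
def homOf {𝒢 ℋ : SemiGraphOfAnabelioids.{v₁, u₁, u}} (φ : SemiGraphOfAnabelioids.Hom 𝒢 ℋ) :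
    (SgAQuot.mk 𝒢 ⟶ SgAQuot.mk ℋ) :=
  homMk φ.over

/-- Every arrow is the class of some 1-morphism. [cite: MochizukiSemiAnbd2006, Rmk 2.4.2, p. 26] -/
theorem homOf_surjective (𝒢 ℋ : SemiGraphOfAnabelioids.{v₁, u₁, u}) :
    Function.Surjective (homOf : SemiGraphOfAnabelioids.Hom 𝒢 ℋ → (SgAQuot.mk 𝒢 ⟶ SgAQuot.mk ℋ)) := by
  rintro ⟨f, a⟩
  induction a using Quotient.ind with
  | _ φ => exact ⟨φ.toHom, rfl⟩

/-- Two 1-morphisms over the same base define the same arrow iff they are 2-isomorphic.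
[cite: MochizukiSemiAnbd2006, Rmk 2.4.2, p. 26] -/
theorem homMk_eq_homMk_iff {X Y : SgAQuot.{v₁, u₁, u}} {f : X.toSgA.graph ⟶ Y.toSgA.graph}
    (φ φ' : HomOver X.toSgA Y.toSgA f) :
    homMk φ = homMk φ' ↔ Nonempty (HomOver.Iso2 φ φ') := by
  constructor
  · intro h
    injection h with _ h₂
    exact Quotient.exact (s := HomOver.iso2Setoid _ _ f) h₂
  · rintro ⟨σ⟩
    exact congrArg (Hom.mk f) (Quotient.sound ⟨σ⟩)

/-- The base of a composite is the composite of the bases. [cite: MochizukiSemiAnbd2006, Rmk 2.4.2, p. 26] -/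
@[simp] theorem comp_base {X Y Z : SgAQuot.{v₁, u₁, u}} (a : X ⟶ Y) (b : Y ⟶ Z) :
    (a ≫ b).base = a.base ≫ b.base := rfl

/-- The base of the identity is the identity. [cite: MochizukiSemiAnbd2006, Rmk 2.4.2, p. 26] -/
@[simp] theorem id_base (X : SgAQuot.{v₁, u₁, u}) : (𝟙 X : X ⟶ X).base = 𝟙 X.toSgA.graph := rfl

/-- The identity arrow is the class of the identity 1-morphism. [cite: MochizukiSemiAnbd2006, Rmk 2.4.2, p. 26] -/
theorem homMk_id (X : SgAQuot.{v₁, u₁, u}) : homMk (HomOver.id X.toSgA) = 𝟙 X := rfl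

/-- Composition of classes of 1-morphisms is the class of the composite.
[cite: MochizukiSemiAnbd2006, Rmk 2.4.2, p. 26] -/
theorem homMk_comp_homMk {X Y Z : SgAQuot.{v₁, u₁, u}} {f : X.toSgA.graph ⟶ Y.toSgA.graph}
    {g : Y.toSgA.graph ⟶ Z.toSgA.graph} (φ : HomOver X.toSgA Y.toSgA f)
    (ψ : HomOver Y.toSgA Z.toSgA g) : homMk φ ≫ homMk ψ = homMk (φ.comp ψ) := rfl

/-- The forgetful functor to semi-graphs ("underlying semi-graph"). [cite: MochizukiSemiAnbd2006, Rmk 2.4.2, p. 26] -/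
def forgetToSemiGraph : SgAQuot.{v₁, u₁, u} ⥤ SemiGraph.{u} where
  obj X := X.toSgA.graph
  map a := a.base

end SgAQuot

end Literature.AnabelianGeometry.SemiGraphs
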